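import Literature.Probability.RandomPlanarGeometry.SAWPolygonsFromBridges
import Literature.Probability.RandomPlanarGeometry.SAWAllTurnUnfoldConcat
import HarnessLib

/-!
# Two all-turn bridges make an all-turn polygon on `ℤ²` («L-POLY» K2)

Topic `Literature/Probability/RandomPlanarGeometry` (continues `SAWPolygonsFromBridges.lean` — Madras–Slade
Theorem 3.2.4 "two bridges make a polygon": `reroot`, `eq_of_reroot_eq`, `phi`, `argmaxPhi/argminPhi` —,
`SAWBendingEnergy.lean` — `Zd.turnAt`, `Zd.turns` — and `SAWAllTurnUnfoldConcat.lean` — the all-turn classes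
`Zd.allTurnBridges`, `Zd.allTurnBridgeCount`). We run the printed construction INSIDE the class of
*all-turn* walks (walks of `ℤ²` turning at every internal vertex = self-avoiding walks of the `L`-lattice):
for even `M ≥ 2`,

  `b^{AT}(M)² ≤ 16 (2M+5)⁴ (M+3)² · q(2M+12)`,

where `b^{AT}(N)` counts the all-turn `N`-step bridges and `q(L)` the rooted oriented all-turn `L`-step
self-avoiding polygons (`Zd.allTurnBridgeCount`, `Zd.allTurnPolygonCount`; statement `Zd.AllTurnPolygonsFromBridges`,
planner a-idea-2 «L-POLY» `Sketch_v9` K2, bodies verbatim). Source mechanism: N. Madras, G. Slade, *The Self-Avoiding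
Walk* (1993), §3.2, proof of Theorem 3.2.4 (re-root both bridges at the extremal levels of `φ = z · v`, `v ⊥ x`, glue
`ῡ`, a connector, the reversal of `ω̄`; decode knowing the two re-rooting times; Cauchy–Schwarz / pigeonhole over the
endpoint classes).

## What is new in the all-turn class

* Step types alternate along an all-turn self-avoiding walk, and a bridge starts with `+e₁`; so an all-turn bridge of
  even length ends with a vertical step, re-rooting (a cyclic permutation of the steps) keeps it all-turn
  (`turns_reroot`), and the types of the first/last steps of the re-rooted walks are fixed by the parities of the
  re-rooting times (`hz_stp_reroot_zero/last`).
* Every even all-turn `M`-bridge extends by `(+e₁, ±e₂)` to an all-turn `(M+2)`-bridge whose endpoint has `x₁ ≠ 0`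
  (`extendBridgeAT`, injective); for such endpoints `x` (and `x₀ ≥ 2`, automatic for all-turn bridges of length `≥ 3`)
  the two re-rooted walks are glued by PARITY-ADAPTIVE CONNECTORS of total length `8` (`off1`/`pos2`, four designs
  indexed by the parities of the two re-rooting times, built from `e = (0,-1)`, `e' = (sgn x₁, 0)`): the middle
  connector descends strictly in `φ`, the closing connector stays strictly inside the open band `(φ(t), 0)`, and all
  junctions turn (`glueAT_mem_allTurnLoops`). Output: rooted all-turn polygons of length exactly `2(M+2)+8`.
* Decoding as printed (`pairCodeAT_injOn`), pigeonhole over the `(2M+5)²` endpoint classes (`allTurnPolygonsFromBridges`).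

[cite: MadrasSlade1993, §3.2, Theorem 3.2.4 (proof)] — lane «pcv-sawmu», a-p1 gen 5, 2026-08-22.
-/

noncomputable section

open Finset Literature.Probability.LatticeModels Literature.Probability.Percolation SimpleGraph
open scoped BigOperators

namespace Literature.Probability.RandomPlanarGeometry.SAW.Zd

/-! ### Objects (planner `Sketch_v9` «L-POLY», bodies verbatim; `allTurnBridges`, `allTurnBridgeCount` are
declared in `SAWAllTurnUnfoldConcat.lean`) -/

open Classical in
/-- Rooted (at `0`), oriented all-turn `L`-step self-avoiding POLYGONS, coded by their first `L-1` steps: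
an `(L-1)`-step all-turn SAW `ω` from `0` whose endpoint is a neighbour of `0`, such that the closing step
`ω(L-1) → 0` turns at both of its ends. [cite: MadrasSlade1993, Definition 3.2.1] -/
def allTurnLoops (L : ℕ) : Finset (ℕ → Site 2) :=
  (saws 2 (L - 1)).filter fun ω =>
    turns (L - 1) ω = L - 2 ∧ (zdGraph 2).Adj (ω (L - 1)) 0 ∧
      (0 : Site 2) - ω (L - 1) ≠ ω (L - 1) - ω (L - 2) ∧ ω 1 - ω 0 ≠ (0 : Site 2) - ω (L - 1)

/-- `q(L)` = number of rooted oriented all-turn `L`-step polygons. [cite: MadrasSlade1993, Definition 3.2.1] -/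
def allTurnPolygonCount (L : ℕ) : ℕ := (allTurnLoops L).card

/-- K2 «L-POLY» (planner statement, verbatim): for even `M ≥ 2`,
`(b^{AT}_M)² ≤ 16 (2M+5)⁴ (M+3)² · q(2M+12)`. [cite: MadrasSlade1993, Theorem 3.2.4] -/
def AllTurnPolygonsFromBridges : Prop :=
  ∀ M : ℕ, 2 ≤ M → Even M →
    allTurnBridgeCount M ^ 2 ≤ 16 * (2 * M + 5) ^ 4 * (M + 3) ^ 2 * allTurnPolygonCount (2 * M + 12)

/-! ### Steps, turns and step types of a walk on `ℤ²` -/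

/-- The `k`-th step `ω(k+1) - ω(k)`. [cite: MadrasSlade1993, §1.1] -/
def stp (ω : ℕ → Site 2) (k : ℕ) : Site 2 := ω (k + 1) - ω k

/-- A step is *horizontal* when its second coordinate vanishes. [cite: MadrasSlade1993, §1.1] -/
def hz (v : Site 2) : Prop := v 1 = 0

/-- Two planar vectors agree iff their two coordinates agree. [folklore] -/
private theorem vec2_eq_iff (u v : Site 2) : u = v ↔ u 0 = v 0 ∧ u 1 = v 1 := by
  constructor
  · rintro rfl; exact ⟨rfl, rfl⟩
  · rintro ⟨h0, h1⟩
    funext j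
    fin_cases j
    · exact h0
    · exact h1

/-- The turn event in terms of steps. [cite: MadrasSlade1993, §1.1] -/
theorem turnAt_iff_stp (N : ℕ) (ω : ℕ → Site 2) (j : ℕ) :
    turnAt N ω j ↔ j + 2 ≤ N ∧ stp ω (j + 1) ≠ stp ω j := Iff.rfl

/-- **All-turn criterion**: `turns N ω = N - 1` iff every pair of consecutive steps differs.
[cite: MadrasSlade1993, §1.1] -/
theorem turns_eq_iff {N : ℕ} {ω : ℕ → Site 2} :
    turns N ω = N - 1 ↔ ∀ j, j + 2 ≤ N → stp ω (j + 1) ≠ stp ω j := by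
  classical
  unfold turns occ
  set S := (Finset.range (N + 1)).filter (turnAt N ω) with hS
  set T := (Finset.range (N + 1)).filter (fun j => j + 2 ≤ N) with hT
  have hST : S ⊆ T := by
    intro j hj
    rw [hS, Finset.mem_filter] at hj
    rw [hT, Finset.mem_filter]
    exact ⟨hj.1, hj.2.1⟩
  have hTeq : T = Finset.range (N - 1) := by
    ext j
    rw [hT, Finset.mem_filter, Finset.mem_range, Finset.mem_range]
    omega
  have hTcard : T.card = N - 1 := by rw [hTeq, Finset.card_range]
  constructor
  · intro h j hj
    have hEq : S = T := Finset.eq_of_subset_of_card_le hST (by rw [hTcard, h])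
    have hjT : j ∈ T := by
      rw [hT, Finset.mem_filter, Finset.mem_range]
      exact ⟨by omega, hj⟩
    rw [← hEq, hS, Finset.mem_filter] at hjT
    exact hjT.2.2
  · intro h
    have hEq : S = T := by
      refine Finset.Subset.antisymm hST fun j hj => ?_
      rw [hT, Finset.mem_filter] at hj
      rw [hS, Finset.mem_filter]
      exact ⟨hj.1, hj.2, h j hj.2⟩
    rw [hEq, hTcard]

/-- A step of a nearest-neighbour walk is one of `±e₁` (horizontal) or `±e₂` (vertical), in coordinates.
[cite: MadrasSlade1993, §3.2 (proof of Theorem 3.2.4)] -/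
theorem stp_coord {N : ℕ} {ω : ℕ → Site 2} (hω : ω ∈ saws 2 N) {k : ℕ} (hk : k < N) :
    (stp ω k 1 = 0 ∧ (stp ω k 0 = 1 ∨ stp ω k 0 = -1)) ∨
      (stp ω k 0 = 0 ∧ (stp ω k 1 = 1 ∨ stp ω k 1 = -1)) := by
  obtain ⟨i, hi | hi⟩ := (zdGraph_adj_iff_sub _ _).1 ((mem_saws.1 hω).2.2.1 k hk)
  · have h0 := congrFun hi 0
    have h1 := congrFun hi 1
    simp only [Pi.sub_apply] at h0 h1
    fin_cases i
    · simp at h0 h1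
      simp only [stp, Pi.sub_apply]
      omega
    · simp at h0 h1
      simp only [stp, Pi.sub_apply]
      omega
  · have h0 := congrFun hi 0
    have h1 := congrFun hi 1
    simp only [Pi.sub_apply] at h0 h1
    fin_cases i
    · simp at h0 h1
      simp only [stp, Pi.sub_apply]
      omega
    · simp at h0 h1
      simp only [stp, Pi.sub_apply]
      omega

/-- A self-avoiding walk never reverses its previous step. [cite: MadrasSlade1993, §3.2 (proof of Theorem 3.2.4)] -/
theorem stp_succ_ne_neg {N : ℕ} {ω : ℕ → Site 2} (hω : ω ∈ saws 2 N) {k : ℕ} (hk : k + 2 ≤ N) :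
    stp ω (k + 1) ≠ -stp ω k := by
  intro h
  have hinj := (mem_saws.1 hω).2.2.2
  have h2 : ω (k + 2) = ω k := by
    have : ω (k + 2) = ω k + stp ω k + stp ω (k + 1) := by
      simp only [stp, show k + 2 = k + 1 + 1 by ring]; abel
    rw [this, h]; abel
  have := hinj (show k + 2 ≤ N from hk) (show k ≤ N by omega) h2
  omega

/-- **At a turn the step type flips** (horizontal ↔ vertical). [cite: MadrasSlade1993, §1.1] -/
theorem hz_iff_not_hz_of_turn {N : ℕ} {ω : ℕ → Site 2} (hω : ω ∈ saws 2 N) {k : ℕ} (hk : k + 2 ≤ N)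
    (ht : stp ω (k + 1) ≠ stp ω k) : (hz (stp ω k) ↔ ¬ hz (stp ω (k + 1))) := by
  have hu := stp_coord hω (show k < N by omega)
  have hv := stp_coord hω (show k + 1 < N by omega)
  have hnr := stp_succ_ne_neg hω hk
  rw [Ne, vec2_eq_iff] at ht hnr
  simp only [Pi.neg_apply] at hnr
  unfold hz
  omega

/-- Steps of different types differ. [cite: MadrasSlade1993, §3.2 (proof of Theorem 3.2.4)] -/
theorem ne_of_hz_iff_not_hz {u v : Site 2} (h : hz u ↔ ¬ hz v) : v ≠ u := by
  rintro rfl; exact iff_not_self h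

/-- Membership in `allTurnBridges`. [cite: MadrasSlade1993, Definition 1.2.4] -/
theorem mem_allTurnBridges {N : ℕ} {ω : ℕ → Site 2} :
    ω ∈ allTurnBridges N ↔ ω ∈ bridges 2 N ∧ turns N ω = N - 1 := by
  classical
  rw [allTurnBridges, Finset.mem_filter]

/-- **Step types alternate along an all-turn bridge, starting horizontal**: step `k` is horizontal iff `k` is
even (the first step of a bridge is `+e₁`). [cite: MadrasSlade1993, §1.1 and Definition 1.2.4] -/
theorem hz_stp_iff_of_mem_allTurnBridges {N : ℕ} {ω : ℕ → Site 2} (hω : ω ∈ allTurnBridges N) :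
    ∀ k < N, (hz (stp ω k) ↔ k % 2 = 0) := by
  obtain ⟨hb, ht⟩ := mem_allTurnBridges.1 hω
  obtain ⟨hs, hbr⟩ := mem_bridges.1 hb
  rw [turns_eq_iff] at ht
  intro k
  induction k with
  | zero =>
    intro hN
    have h1 := (hbr 1 le_rfl (by omega)).1
    have h0 : ω 0 = 0 := (mem_saws.1 hs).1
    have hc := stp_coord hs hN
    have : stp ω 0 0 = ω 1 0 := by simp [stp, h0]
    rw [h0] at h1
    simp only [Pi.zero_apply] at h1
    unfold hz
    omega
  | succ k ih =>
    intro hk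
    have hflip := hz_iff_not_hz_of_turn hs (show k + 2 ≤ N by omega) (ht k (by omega))
    rw [ih (by omega)] at hflip
    constructor
    · intro h
      by_contra hne
      exact hflip.1 (by omega) h
    · intro h
      by_contra h'
      have := hflip.2 h'
      omega

/-- An all-turn bridge of length `≥ 3` ends at `x₀ ≥ 2` (its first three steps are `+e₁, ±e₂, +e₁`).
[cite: MadrasSlade1993, Definition 1.2.4] -/
theorem two_le_apply_zero_of_mem_allTurnBridges {M : ℕ} {ω : ℕ → Site 2} (hω : ω ∈ allTurnBridges M)
    (hM : 3 ≤ M) : 2 ≤ ω M 0 := by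
  obtain ⟨hb, _⟩ := mem_allTurnBridges.1 hω
  obtain ⟨hs, hbr⟩ := mem_bridges.1 hb
  have h0 : ω 0 = 0 := (mem_saws.1 hs).1
  have hpar := hz_stp_iff_of_mem_allTurnBridges hω
  have e1 := hpar 1 (by omega)
  have e2 := hpar 2 (by omega)
  have c0 := stp_coord hs (show 0 < M by omega)
  have c1 := stp_coord hs (show 1 < M by omega)
  have c2 := stp_coord hs (show 2 < M by omega)
  have hb3 := hbr 3 (by omega) hM
  have hb1 := hbr 1 (by omega) (by omega)
  have hb2 := hbr 2 (by omega) (by omega)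
  have e1' : ¬ hz (stp ω 1) := fun h => by have := e1.1 h; omega
  have e2' : hz (stp ω 2) := e2.2 (by omega)
  unfold hz at e1' e2'
  simp only [stp, Pi.sub_apply, Nat.reduceAdd] at c0 c1 c2 e1' e2'
  have h00 : ω 0 0 = 0 := by rw [h0]; rfl
  rw [h00] at hb3 hb1 hb2
  omega

/-! ### Re-rooting inside the all-turn class -/

section Reroot

variable {M i : ℕ} {ω : ℕ → Site 2}

/-- The steps of the re-rooted walk are the steps of `ω`, cyclically permuted (`k ↦ i + k mod M`).
[cite: MadrasSlade1993, §3.2 (proof of Theorem 3.2.4)] -/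
theorem stp_reroot (hω : ω 0 = 0) {k : ℕ} (hk : k < M) :
    stp (reroot M i ω) k = stp ω (if i + k < M then i + k else i + k - M) := by
  simp only [stp]
  rw [reroot_of_le hk.le, reroot_of_le (Nat.succ_le_of_lt hk), sub_sub_sub_cancel_right]
  by_cases h1 : i + k < M
  · rw [if_pos h1, rerootRaw_of_le h1.le, rerootRaw_of_le (show i + (k + 1) ≤ M by omega),
      show i + (k + 1) = i + k + 1 by ring]
  · rw [if_neg h1]
    by_cases h2 : i + k = M
    · rw [rerootRaw_of_le h2.le, rerootRaw_of_lt (show M < i + (k + 1) by omega), h2,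
        show i + (k + 1) - M = 0 + 1 by omega, Nat.sub_self, hω]
      simp
    · rw [rerootRaw_of_lt (show M < i + k by omega), rerootRaw_of_lt (show M < i + (k + 1) by omega),
        show i + (k + 1) - M = i + k - M + 1 by omega]
      abel

/-- **Re-rooting an all-turn bridge of even length gives an all-turn walk** (the wrap junction puts the
last step, vertical, before the first step `+e₁`). [cite: MadrasSlade1993, §3.2 (proof of Theorem 3.2.4)] -/
theorem turns_reroot (hω : ω ∈ allTurnBridges M) (hev : Even M) (hi : i ≤ M) :
    turns M (reroot M i ω) = M - 1 := by
  obtain ⟨hb, ht⟩ := mem_allTurnBridges.1 hω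
  have hs := (mem_bridges.1 hb).1
  have h0 : ω 0 = 0 := (mem_saws.1 hs).1
  have hpar := hz_stp_iff_of_mem_allTurnBridges hω
  rw [turns_eq_iff] at ht ⊢
  intro j hj
  rw [stp_reroot (i := i) h0 (show j + 1 < M by omega), stp_reroot (i := i) h0 (show j < M by omega)]
  by_cases h1 : i + j + 1 < M
  · rw [if_pos (show i + (j + 1) < M by omega), if_pos (show i + j < M by omega),
      show i + (j + 1) = i + j + 1 by ring]
    exact ht (i + j) (by omega)
  · by_cases h2 : i + j + 1 = M
    · rw [if_neg (show ¬ (i + (j + 1) < M) by omega), if_pos (show i + j < M by omega),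
        show i + (j + 1) - M = 0 by omega, show i + j = M - 1 by omega]
      refine ne_of_hz_iff_not_hz ?_
      rw [hpar (M - 1) (by omega), hpar 0 (by omega)]
      obtain ⟨r, hr⟩ := hev
      omega
    · rw [if_neg (show ¬ (i + (j + 1) < M) by omega), if_neg (show ¬ (i + j < M) by omega),
        show i + (j + 1) - M = i + j - M + 1 by omega]
      exact ht (i + j - M) (by omega)

/-- The first step of the walk re-rooted at time `i` is horizontal iff `i` is even.
[cite: MadrasSlade1993, §3.2 (proof of Theorem 3.2.4)] -/
theorem hz_stp_reroot_zero (hω : ω ∈ allTurnBridges M) (hev : Even M) (hM : 1 ≤ M) (hi : i ≤ M) :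
    (hz (stp (reroot M i ω) 0) ↔ i % 2 = 0) := by
  have hs := (mem_bridges.1 (mem_allTurnBridges.1 hω).1).1
  have h0 : ω 0 = 0 := (mem_saws.1 hs).1
  have hpar := hz_stp_iff_of_mem_allTurnBridges hω
  rw [stp_reroot (i := i) h0 (show 0 < M by omega)]
  by_cases h : i < M
  · rw [if_pos (by omega), add_zero]
    exact hpar i h
  · rw [if_neg (by omega), show i + 0 - M = 0 by omega, hpar 0 (by omega)]
    obtain ⟨r, hr⟩ := hev
    omega

/-- The last step of the walk re-rooted at time `i` is horizontal iff `i` is odd.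
[cite: MadrasSlade1993, §3.2 (proof of Theorem 3.2.4)] -/
theorem hz_stp_reroot_last (hω : ω ∈ allTurnBridges M) (hev : Even M) (hM : 1 ≤ M) (hi : i ≤ M) :
    (hz (stp (reroot M i ω) (M - 1)) ↔ i % 2 = 1) := by
  have hs := (mem_bridges.1 (mem_allTurnBridges.1 hω).1).1
  have h0 : ω 0 = 0 := (mem_saws.1 hs).1
  have hpar := hz_stp_iff_of_mem_allTurnBridges hω
  rw [stp_reroot (i := i) h0 (show M - 1 < M by omega)]
  by_cases h : i = 0
  · subst h
    rw [if_pos (by omega), hpar (0 + (M - 1)) (by omega)]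
    obtain ⟨r, hr⟩ := hev
    omega
  · rw [if_neg (by omega), show i + (M - 1) - M = i - 1 by omega, hpar (i - 1) (by omega)]
    omega

end Reroot

/-! ### Parity-adaptive connectors (four designs, indexed by the parities `pj`, `pi` of the re-rooting times) -/

section Connectors

/-- Number of steps of the middle connector: `3` for equal parities, `4` for mixed ones (the closing connector has
`8 - len1` steps). [cite: MadrasSlade1993, §3.2 (proof of Theorem 3.2.4)] -/
def len1 : Bool → Bool → ℕ
  | true, true => 3
  | false, false => 3
  | _, _ => 4

/-- The middle connector, as cumulative offsets from `x` after `m` steps (frozen at its total displacement `t`);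
`s = sgn x₁`, `e = (0,-1)`, `e' = (s, 0)`: designs `(e,e',e,e')`, `(e',e,e',e)`, `(e,e',e)`, `(e',e,e')`.
[cite: MadrasSlade1993, §3.2 (proof of Theorem 3.2.4)] -/
def off1 (s : ℤ) : Bool → Bool → ℕ → Site 2
  | _, _, 0 => 0
  | true, false, 1 => ![0, -1]
  | true, false, 2 => ![s, -1]
  | true, false, 3 => ![s, -2]
  | true, false, _ + 4 => ![2 * s, -2]
  | false, true, 1 => ![s, 0]
  | false, true, 2 => ![s, -1]
  | false, true, 3 => ![2 * s, -1]
  | false, true, _ + 4 => ![2 * s, -2]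
  | true, true, 1 => ![0, -1]
  | true, true, 2 => ![s, -1]
  | true, true, _ + 3 => ![s, -2]
  | false, false, 1 => ![s, 0]
  | false, false, 2 => ![s, -1]
  | false, false, _ + 3 => ![2 * s, -1]

/-- The closing connector, as absolute positions after `m` steps from `t` (frozen at its last vertex, a neighbour
of `0`): designs `(-e,ē',-e,ē')`, `(ē',-e,ē',-e)`, `(ē',-e,e',-e,ē')`, `(-e,ē',e,ē',-e)` (`ē' = -e'`).
[cite: MadrasSlade1993, §3.2 (proof of Theorem 3.2.4)] -/
def pos2 (s : ℤ) : Bool → Bool → ℕ → Site 2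
  | true, false, 0 => ![2 * s, -2]
  | true, false, 1 => ![2 * s, -1]
  | true, false, 2 => ![s, -1]
  | true, false, _ + 3 => ![s, 0]
  | false, true, 0 => ![2 * s, -2]
  | false, true, 1 => ![s, -2]
  | false, true, 2 => ![s, -1]
  | false, true, _ + 3 => ![0, -1]
  | true, true, 0 => ![s, -2]
  | true, true, 1 => ![0, -2]
  | true, true, 2 => ![0, -1]
  | true, true, 3 => ![s, -1]
  | true, true, _ + 4 => ![s, 0]
  | false, false, 0 => ![2 * s, -1]
  | false, false, 1 => ![2 * s, 0]
  | false, false, 2 => ![s, 0]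
  | false, false, 3 => ![s, -1]
  | false, false, _ + 4 => ![0, -1]

variable {s : ℤ} {pj pi : Bool}

/-- `3 ≤ len1 ≤ 4`. [cite: MadrasSlade1993, §3.2 (proof of Theorem 3.2.4)] -/
theorem len1_le (pj pi : Bool) : 3 ≤ len1 pj pi ∧ len1 pj pi ≤ 4 := by
  cases pj <;> cases pi <;> simp [len1]

/-- The middle connector starts at `x`. [cite: MadrasSlade1993, §3.2 (proof of Theorem 3.2.4)] -/
@[simp] theorem off1_zero (s : ℤ) (pj pi : Bool) : off1 s pj pi 0 = 0 := by
  cases pj <;> cases pi <;> rfl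

/-- The middle connector is frozen after `len1` steps. [cite: MadrasSlade1993, §3.2 (proof of Theorem 3.2.4)] -/
theorem off1_of_ge (s : ℤ) {pj pi : Bool} {m : ℕ} (hm : len1 pj pi ≤ m) :
    off1 s pj pi m = off1 s pj pi (len1 pj pi) := by
  cases pj <;> cases pi <;> simp only [len1] at hm ⊢
  · obtain ⟨n, rfl⟩ : ∃ n, m = n + 3 := ⟨m - 3, by omega⟩
    cases n <;> rfl
  · obtain ⟨n, rfl⟩ : ∃ n, m = n + 4 := ⟨m - 4, by omega⟩
    rfl
  · obtain ⟨n, rfl⟩ : ∃ n, m = n + 4 := ⟨m - 4, by omega⟩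
    rfl
  · obtain ⟨n, rfl⟩ : ∃ n, m = n + 3 := ⟨m - 3, by omega⟩
    cases n <;> rfl

/-- The closing connector starts where the middle one ends (at `t`, the image of the origin of the reversed walk).
[cite: MadrasSlade1993, §3.2 (proof of Theorem 3.2.4)] -/
theorem pos2_zero (s : ℤ) (pj pi : Bool) : pos2 s pj pi 0 = off1 s pj pi (len1 pj pi) := by
  cases pj <;> cases pi <;> rfl

/-- The closing connector is frozen after `7 - len1` steps. [cite: MadrasSlade1993, §3.2 (proof of Theorem 3.2.4)] -/
theorem pos2_of_ge (s : ℤ) {pj pi : Bool} {m : ℕ} (hm : 7 - len1 pj pi ≤ m) :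
    pos2 s pj pi m = pos2 s pj pi (7 - len1 pj pi) := by
  cases pj <;> cases pi <;> simp only [len1] at hm ⊢
  · obtain ⟨n, rfl⟩ : ∃ n, m = n + 4 := ⟨m - 4, by omega⟩
    rfl
  · obtain ⟨n, rfl⟩ : ∃ n, m = n + 3 := ⟨m - 3, by omega⟩
    rfl
  · obtain ⟨n, rfl⟩ : ∃ n, m = n + 3 := ⟨m - 3, by omega⟩
    rfl
  · obtain ⟨n, rfl⟩ : ∃ n, m = n + 4 := ⟨m - 4, by omega⟩
    rfl

/-- Adjacency on `ℤ²` from coordinates. [folklore] -/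
private theorem adj_of_coords {u v : Site 2}
    (h : (v 0 = u 0 ∧ (v 1 = u 1 + 1 ∨ v 1 + 1 = u 1)) ∨ (v 1 = u 1 ∧ (v 0 = u 0 + 1 ∨ v 0 + 1 = u 0))) :
    (zdGraph 2).Adj u v := by
  rw [zdGraph_adj_iff_sub]
  rcases h with ⟨h0, h1 | h1⟩ | ⟨h1, h0 | h0⟩
  · exact ⟨1, Or.inl (by funext j; fin_cases j <;> simp <;> omega)⟩
  · exact ⟨1, Or.inr (by funext j; fin_cases j <;> simp <;> omega)⟩
  · exact ⟨0, Or.inl (by funext j; fin_cases j <;> simp <;> omega)⟩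
  · exact ⟨0, Or.inr (by funext j; fin_cases j <;> simp <;> omega)⟩

/-- Consecutive vertices of the middle connector are adjacent. [cite: MadrasSlade1993, §3.2 (proof of Theorem 3.2.4)] -/
theorem adj_off1 (hs : s = 1 ∨ s = -1) {m : ℕ} (hm : m < len1 pj pi) :
    (zdGraph 2).Adj (off1 s pj pi m) (off1 s pj pi (m + 1)) := by
  rcases hs with rfl | rfl <;> cases pj <;> cases pi <;> simp only [len1] at hm <;>
    interval_cases m <;> exact adj_of_coords (by simp [off1])

/-- Consecutive vertices of the closing connector are adjacent. [cite: MadrasSlade1993, §3.2 (proof of Theorem 3.2.4)] -/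
theorem adj_pos2 (hs : s = 1 ∨ s = -1) {m : ℕ} (hm : m < 7 - len1 pj pi) :
    (zdGraph 2).Adj (pos2 s pj pi m) (pos2 s pj pi (m + 1)) := by
  rcases hs with rfl | rfl <;> cases pj <;> cases pi <;> simp only [len1] at hm <;>
    interval_cases m <;> exact adj_of_coords (by simp [pos2])

/-- The last vertex of the closing connector is a neighbour of the origin. [cite: MadrasSlade1993, §3.2 (proof of Theorem 3.2.4)] -/
theorem adj_pos2_zero (hs : s = 1 ∨ s = -1) (pj pi : Bool) :
    (zdGraph 2).Adj (pos2 s pj pi (7 - len1 pj pi)) 0 := by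
  rcases hs with rfl | rfl <;> cases pj <;> cases pi <;> exact adj_of_coords (by simp [pos2, len1])

end Connectors

section ConnectorFacts

variable {s : ℤ} {pj pi : Bool} {x : Site 2}

/-- `φₓ(t) < 0` for the total displacement `t` of the middle connector (`x₀ ≥ 1`, `s x₁ > 0`). [cite: MadrasSlade1993, §3.2 (proof of Theorem 3.2.4)] -/
theorem phi_off1_len1_neg (hx0 : 1 ≤ x 0) (hsx : (s = 1 ∧ 0 < x 1) ∨ (s = -1 ∧ x 1 < 0)) :
    phi x (off1 s pj pi (len1 pj pi)) < 0 := by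
  rcases hsx with ⟨rfl, h1⟩ | ⟨rfl, h1⟩ <;> cases pj <;> cases pi <;> simp [phi, off1, len1] <;> omega

/-- The interior vertices of the middle connector lie strictly inside the band `φₓ(t) < φₓ < 0`. [cite: MadrasSlade1993, §3.2 (proof of Theorem 3.2.4)] -/
theorem phi_off1_mem (hx0 : 1 ≤ x 0) (hsx : (s = 1 ∧ 0 < x 1) ∨ (s = -1 ∧ x 1 < 0)) {m : ℕ}
    (h1 : 1 ≤ m) (h2 : m < len1 pj pi) :
    phi x (off1 s pj pi (len1 pj pi)) < phi x (off1 s pj pi m) ∧ phi x (off1 s pj pi m) < 0 := by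
  rcases hsx with ⟨rfl, hx1⟩ | ⟨rfl, hx1⟩ <;> cases pj <;> cases pi <;> simp only [len1] at h2 ⊢ <;>
    interval_cases m <;> simp [phi, off1] <;> omega

/-- The vertices of the closing connector (before `0`) lie strictly inside the band `φₓ(t) < φₓ < 0`. [cite: MadrasSlade1993, §3.2 (proof of Theorem 3.2.4)] -/
theorem phi_pos2_mem (hx0 : 1 ≤ x 0) (hsx : (s = 1 ∧ 0 < x 1) ∨ (s = -1 ∧ x 1 < 0)) {m : ℕ}
    (h1 : 1 ≤ m) (h2 : m ≤ 7 - len1 pj pi) :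
    phi x (off1 s pj pi (len1 pj pi)) < phi x (pos2 s pj pi m) ∧ phi x (pos2 s pj pi m) < 0 := by
  rcases hsx with ⟨rfl, hx1⟩ | ⟨rfl, hx1⟩ <;> cases pj <;> cases pi <;> simp only [len1] at h2 ⊢ <;>
    interval_cases m <;> simp [phi, off1, pos2] <;> omega

/-- The interior vertices of the middle connector are pairwise distinct. [cite: MadrasSlade1993, §3.2 (proof of Theorem 3.2.4)] -/
theorem off1_ne_off1 (hs : s = 1 ∨ s = -1) {m m' : ℕ} (h1 : 1 ≤ m) (h2 : m < m') (h3 : m' < len1 pj pi) :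
    off1 s pj pi m ≠ off1 s pj pi m' := by
  rcases hs with rfl | rfl <;> cases pj <;> cases pi <;> simp only [len1] at h3 <;>
    interval_cases m' <;> interval_cases m <;> simp [off1]

/-- The vertices of the closing connector are pairwise distinct. [cite: MadrasSlade1993, §3.2 (proof of Theorem 3.2.4)] -/
theorem pos2_ne_pos2 (hs : s = 1 ∨ s = -1) {m m' : ℕ} (h1 : 1 ≤ m) (h2 : m < m') (h3 : m' ≤ 7 - len1 pj pi) :
    pos2 s pj pi m ≠ pos2 s pj pi m' := by
  rcases hs with rfl | rfl <;> cases pj <;> cases pi <;> simp only [len1] at h3 <;>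
    interval_cases m' <;> interval_cases m <;> simp [pos2]

/-- No vertex of the middle connector is a vertex of the closing connector (`x₀ ≥ 2`). [cite: MadrasSlade1993, §3.2 (proof of Theorem 3.2.4)] -/
theorem off1_ne_pos2 (hx0 : 2 ≤ x 0) (hsx : (s = 1 ∧ 0 < x 1) ∨ (s = -1 ∧ x 1 < 0)) {m m' : ℕ}
    (h1 : 1 ≤ m) (h2 : m < len1 pj pi) (h3 : 1 ≤ m') (h4 : m' ≤ 7 - len1 pj pi) :
    x + off1 s pj pi m ≠ pos2 s pj pi m' := by
  rcases hsx with ⟨rfl, hx1⟩ | ⟨rfl, hx1⟩ <;> cases pj <;> cases pi <;> simp only [len1] at h2 h4 <;>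
    interval_cases m <;> interval_cases m' <;>
    (intro h; have e0 := congrFun h 0; have e1 := congrFun h 1; simp [off1, pos2] at e0 e1; omega)

/-- Junction at `x`: the first middle-connector step has the type opposite to the last step of `σ`. [cite: MadrasSlade1993, §3.2 (proof of Theorem 3.2.4)] -/
theorem off1_one_ne (hs : s = 1 ∨ s = -1) {u : Site 2} (hu : hz u ↔ pj = true) :
    off1 s pj pi 1 - off1 s pj pi 0 ≠ u := by
  intro h
  have e1 := congrFun h 1
  rcases hs with rfl | rfl <;> cases pj <;> cases pi <;> simp [off1, hz] at e1 hu <;> omega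

/-- The middle connector turns at its interior vertices. [cite: MadrasSlade1993, §3.2 (proof of Theorem 3.2.4)] -/
theorem off1_turn (hs : s = 1 ∨ s = -1) {m : ℕ} (hm : m + 2 ≤ len1 pj pi) :
    off1 s pj pi (m + 2) - off1 s pj pi (m + 1) ≠ off1 s pj pi (m + 1) - off1 s pj pi m := by
  have hm' : m ≤ 2 := by have := len1_le pj pi; omega
  rcases hs with rfl | rfl <;> cases pj <;> cases pi <;> interval_cases m <;> simp [off1, vec2_eq_iff]

/-- Junction at `x + t`: the last middle-connector step has the type opposite to the (reversed) last step of `τ`.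
[cite: MadrasSlade1993, §3.2 (proof of Theorem 3.2.4)] -/
theorem neg_ne_off1_last (hs : s = 1 ∨ s = -1) {u : Site 2} (hu : hz u ↔ pi = true) :
    -u ≠ off1 s pj pi (len1 pj pi) - off1 s pj pi (len1 pj pi - 1) := by
  intro h
  have e1 := congrFun h 1
  rcases hs with rfl | rfl <;> cases pj <;> cases pi <;> simp [off1, len1, hz] at e1 hu <;> omega

/-- Junction at `t`: the first closing-connector step has the type opposite to the (reversed) first step of `τ`.
[cite: MadrasSlade1993, §3.2 (proof of Theorem 3.2.4)] -/
theorem pos2_one_ne (hs : s = 1 ∨ s = -1) {u : Site 2} (hu : hz u ↔ pi = false) :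
    pos2 s pj pi 1 - pos2 s pj pi 0 ≠ -u := by
  intro h
  have e1 := congrFun h 1
  rcases hs with rfl | rfl <;> cases pj <;> cases pi <;> simp [pos2, hz] at e1 hu <;> omega

/-- The closing connector turns at its interior vertices. [cite: MadrasSlade1993, §3.2 (proof of Theorem 3.2.4)] -/
theorem pos2_turn (hs : s = 1 ∨ s = -1) {m : ℕ} (hm : m + 2 ≤ 7 - len1 pj pi) :
    pos2 s pj pi (m + 2) - pos2 s pj pi (m + 1) ≠ pos2 s pj pi (m + 1) - pos2 s pj pi m := by
  have hm' : m ≤ 2 := by have := len1_le pj pi; omega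
  rcases hs with rfl | rfl <;> cases pj <;> cases pi <;> interval_cases m <;> simp [pos2, vec2_eq_iff]

/-- The closing step into the origin turns relative to the previous step. [cite: MadrasSlade1993, §3.2 (proof of Theorem 3.2.4)] -/
theorem zero_sub_pos2_ne (hs : s = 1 ∨ s = -1) (pj pi : Bool) :
    (0 : Site 2) - pos2 s pj pi (7 - len1 pj pi) ≠
      pos2 s pj pi (7 - len1 pj pi) - pos2 s pj pi (7 - len1 pj pi - 1) := by
  rcases hs with rfl | rfl <;> cases pj <;> cases pi <;> simp [pos2, len1]

/-- The first step of the polygon turns relative to the closing step. [cite: MadrasSlade1993, §3.2 (proof of Theorem 3.2.4)] -/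
theorem ne_zero_sub_pos2 (hs : s = 1 ∨ s = -1) {u : Site 2} (hu : hz u ↔ pj = false) :
    u ≠ (0 : Site 2) - pos2 s pj pi (7 - len1 pj pi) := by
  intro h
  have e1 := congrFun h 1
  rcases hs with rfl | rfl <;> cases pj <;> cases pi <;> simp [pos2, len1, hz] at e1 hu <;> omega

end ConnectorFacts

/-! ### Gluing two all-turn walks through the connectors -/

section Glue

variable {M : ℕ} {s : ℤ} {pj pi : Bool} {σ τ : ℕ → Site 2} {x : Site 2}

/-- `ρ`: the walk `σ` (`= ῡ`), the middle connector from `x` to `x + t`, the walk `τ` (`= ω̄`) reversed and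
translated by `t`, then the closing connector from `t` to a neighbour of `0` (frozen there) — the all-turn edition
of "`ῡ`, one step `e`, the reversal of `ω̄`". [cite: MadrasSlade1993, §3.2 (proof of Theorem 3.2.4)] -/
def glueAT (M : ℕ) (s : ℤ) (pj pi : Bool) (σ τ : ℕ → Site 2) (k : ℕ) : Site 2 :=
  if k ≤ M then σ k
  else if k ≤ M + len1 pj pi then σ M + off1 s pj pi (k - M)
  else if k ≤ 2 * M + len1 pj pi then τ (2 * M + len1 pj pi - k) + off1 s pj pi (len1 pj pi)
  else pos2 s pj pi (k - (2 * M + len1 pj pi))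

/-- First piece of `ρ`: `σ`. [cite: MadrasSlade1993, §3.2 (proof of Theorem 3.2.4)] -/
theorem glueAT_of_le {k : ℕ} (hk : k ≤ M) : glueAT M s pj pi σ τ k = σ k := if_pos hk

/-- Second piece of `ρ`: the middle connector from `x = σ(M)`. [cite: MadrasSlade1993, §3.2 (proof of Theorem 3.2.4)] -/
theorem glueAT_mid1 (hσM : σ M = x) {k : ℕ} (hk : M ≤ k) (hk' : k ≤ M + len1 pj pi) :
    glueAT M s pj pi σ τ k = x + off1 s pj pi (k - M) := by
  unfold glueAT
  by_cases h : k ≤ M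
  · obtain rfl : k = M := le_antisymm h hk
    rw [if_pos h, Nat.sub_self, off1_zero, add_zero, hσM]
  · rw [if_neg h, if_pos hk', hσM]

/-- Third piece of `ρ`: `τ` reversed, translated by `t`. [cite: MadrasSlade1993, §3.2 (proof of Theorem 3.2.4)] -/
theorem glueAT_mid2 (hσM : σ M = x) (hτM : τ M = x) {k : ℕ} (hk : M + len1 pj pi ≤ k)
    (hk' : k ≤ 2 * M + len1 pj pi) :
    glueAT M s pj pi σ τ k = τ (2 * M + len1 pj pi - k) + off1 s pj pi (len1 pj pi) := by
  unfold glueAT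
  have c3 := (len1_le pj pi).1
  rw [if_neg (by omega)]
  by_cases h : k ≤ M + len1 pj pi
  · rw [if_pos h, show k - M = len1 pj pi by omega, show 2 * M + len1 pj pi - k = M by omega, hτM, hσM]
  · rw [if_neg h, if_pos hk']

/-- Last piece of `ρ`: the closing connector (frozen at its last vertex). [cite: MadrasSlade1993, §3.2 (proof of Theorem 3.2.4)] -/
theorem glueAT_end (hτ0 : τ 0 = 0) (hM : 1 ≤ M) {k : ℕ} (hk : 2 * M + len1 pj pi ≤ k) :
    glueAT M s pj pi σ τ k = pos2 s pj pi (k - (2 * M + len1 pj pi)) := by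
  unfold glueAT
  have c3 := (len1_le pj pi).1
  rw [if_neg (by omega), if_neg (by omega)]
  by_cases h : k ≤ 2 * M + len1 pj pi
  · rw [if_pos h, show 2 * M + len1 pj pi - k = 0 by omega, hτ0, zero_add,
      show k - (2 * M + len1 pj pi) = 0 by omega, pos2_zero]
  · rw [if_neg h]

/-- **The glued walk is a rooted all-turn polygon of length `2M + 8`.** Hypotheses: `σ`, `τ` are `M`-step
self-avoiding walks from `0` to the same `x` with `x₀ ≥ 2`, `s x₁ > 0` (`s = ±1`), `φₓ ≥ 0` on `σ` and `≤ 0` on `τ`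
("the hyperplane … separates"), both all-turn, and the types of their first/last steps are the ones dictated by
the parities `pj`, `pi` (`hz` = horizontal). Then `ρ` is self-avoiding (five vertex groups separated by the levels
`0` and `φₓ(t)` of `φₓ`, the connector vertices being explicit), all-turn including all junctions, ends at a
neighbour of `0`, and the closing step turns at both ends. [cite: MadrasSlade1993, §3.2 (proof of Theorem 3.2.4)] -/
theorem glueAT_mem_allTurnLoops (hM : 1 ≤ M) (hσ : σ ∈ saws 2 M) (hτ : τ ∈ saws 2 M)
    (hσM : σ M = x) (hτM : τ M = x) (hx0 : 2 ≤ x 0) (hsx : (s = 1 ∧ 0 < x 1) ∨ (s = -1 ∧ x 1 < 0))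
    (hσφ : ∀ k ≤ M, 0 ≤ phi x (σ k)) (hτφ : ∀ k ≤ M, phi x (τ k) ≤ 0)
    (hσt : ∀ j, j + 2 ≤ M → stp σ (j + 1) ≠ stp σ j) (hτt : ∀ j, j + 2 ≤ M → stp τ (j + 1) ≠ stp τ j)
    (hσL : hz (stp σ (M - 1)) ↔ pj = true) (hσF : hz (stp σ 0) ↔ pj = false)
    (hτL : hz (stp τ (M - 1)) ↔ pi = true) (hτF : hz (stp τ 0) ↔ pi = false) :
    glueAT M s pj pi σ τ ∈ allTurnLoops (2 * M + 8) := by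
  classical
  have hs : s = 1 ∨ s = -1 := by
    rcases hsx with ⟨h, -⟩ | ⟨h, -⟩
    exacts [Or.inl h, Or.inr h]
  have hx0' : 1 ≤ x 0 := by omega
  obtain ⟨hσ0, -, hσadj, hσinj⟩ := mem_saws.1 hσ
  obtain ⟨hτ0, -, hτadj, hτinj⟩ := mem_saws.1 hτ
  obtain ⟨c3, c4⟩ := len1_le pj pi
  set c := len1 pj pi with hc
  set ρ := glueAT M s pj pi σ τ with hρ
  -- positions
  have P1 : ∀ k ≤ M, ρ k = σ k := fun k hk => glueAT_of_le hk
  have P2 : ∀ k, M ≤ k → k ≤ M + c → ρ k = x + off1 s pj pi (k - M) := fun k hk hk' =>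
    glueAT_mid1 hσM hk hk'
  have P3 : ∀ k, M + c ≤ k → k ≤ 2 * M + c → ρ k = τ (2 * M + c - k) + off1 s pj pi c :=
    fun k hk hk' => glueAT_mid2 hσM hτM hk hk'
  have P4 : ∀ k, 2 * M + c ≤ k → ρ k = pos2 s pj pi (k - (2 * M + c)) := fun k hk =>
    glueAT_end hτ0 hM hk
  -- steps
  have S1 : ∀ k < M, stp ρ k = stp σ k := fun k hk => by
    simp only [stp, P1 k hk.le, P1 (k + 1) (Nat.succ_le_of_lt hk)]
  have S2 : ∀ k, M ≤ k → k < M + c → stp ρ k = off1 s pj pi (k + 1 - M) - off1 s pj pi (k - M) :=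
    fun k hk hk' => by
    simp only [stp]
    rw [P2 k hk hk'.le, P2 (k + 1) (by omega) (by omega), add_sub_add_left_eq_sub]
  have S3 : ∀ k, M + c ≤ k → k < 2 * M + c → stp ρ k = -stp τ (2 * M + c - k - 1) := fun k hk hk' => by
    simp only [stp]
    rw [P3 k hk hk'.le, P3 (k + 1) (by omega) (by omega), add_sub_add_right_eq_sub, neg_sub]
    set n := 2 * M + c - k - 1 with hn
    rw [show 2 * M + c - (k + 1) = n by omega, show 2 * M + c - k = n + 1 by omega]
  have S4 : ∀ k, 2 * M + c ≤ k →
      stp ρ k = pos2 s pj pi (k + 1 - (2 * M + c)) - pos2 s pj pi (k - (2 * M + c)) := fun k hk => by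
    simp only [stp]
    rw [P4 k hk, P4 (k + 1) (by omega)]
  -- `φ` levels
  have ht : phi x (off1 s pj pi c) < 0 := phi_off1_len1_neg hx0' hsx
  have F1 : ∀ k ≤ M, 0 ≤ phi x (ρ k) := fun k hk => by rw [P1 k hk]; exact hσφ k hk
  have F2 : ∀ k, M < k → k < M + c → phi x (off1 s pj pi c) < phi x (ρ k) ∧ phi x (ρ k) < 0 :=
    fun k hk hk' => by
    rw [P2 k hk.le hk'.le, phi_add, phi_self, zero_add]
    exact phi_off1_mem hx0' hsx (by omega) (by omega)
  have F3 : ∀ k, M + c ≤ k → k ≤ 2 * M + c → phi x (ρ k) ≤ phi x (off1 s pj pi c) := fun k hk hk' => by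
    rw [P3 k hk hk', phi_add]
    have := hτφ (2 * M + c - k) (by omega)
    linarith
  have F4 : ∀ k, 2 * M + c < k → k ≤ 2 * M + 7 →
      phi x (off1 s pj pi c) < phi x (ρ k) ∧ phi x (ρ k) < 0 := fun k hk hk' => by
    rw [P4 k hk.le]
    exact phi_pos2_mem hx0' hsx (by omega) (by omega)
  -- pairwise distinctness of the vertices
  have key : ∀ a b, a < b → b ≤ 2 * M + 7 → ρ a ≠ ρ b := by
    intro a b hab hb heq
    rcases le_or_gt b M with h1 | h1
    · rw [P1 a (by omega), P1 b h1] at heq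
      have := hσinj (show a ≤ M by omega) (show b ≤ M from h1) heq
      omega
    rcases lt_or_ge b (M + c) with h2 | h2
    · rcases le_or_gt a M with h3 | h3
      · have := F1 a h3; have := F2 b h1 h2; rw [heq] at *; linarith
      · rw [P2 a h3.le (by omega), P2 b h1.le h2.le] at heq
        exact off1_ne_off1 hs (show 1 ≤ a - M by omega) (show a - M < b - M by omega) (by omega)
          (add_left_cancel heq)
    rcases le_or_gt b (2 * M + c) with h3 | h3
    · rcases le_or_gt a M with h4 | h4
      · have := F1 a h4; have := F3 b h2 h3; rw [heq] at *; linarith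
      rcases lt_or_ge a (M + c) with h5 | h5
      · have := F2 a h4 h5; have := F3 b h2 h3; rw [heq] at *; linarith
      · rw [P3 a h5 (by omega), P3 b h2 h3] at heq
        have := hτinj (show 2 * M + c - a ≤ M by omega) (show 2 * M + c - b ≤ M by omega)
          (add_right_cancel heq)
        omega
    · rcases le_or_gt a M with h4 | h4
      · have := F1 a h4; have := F4 b h3 hb; rw [heq] at *; linarith
      rcases lt_or_ge a (M + c) with h5 | h5
      · rw [P2 a h4.le h5.le, P4 b h3.le] at heq
        exact off1_ne_pos2 hx0 hsx (show 1 ≤ a - M by omega) (show a - M < len1 pj pi by omega)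
          (show 1 ≤ b - (2 * M + c) by omega) (show b - (2 * M + c) ≤ 7 - len1 pj pi by omega) heq
      rcases le_or_gt a (2 * M + c) with h6 | h6
      · have := F3 a h5 h6; have := F4 b h3 hb; rw [heq] at *; linarith
      · rw [P4 a h6.le, P4 b h3.le] at heq
        exact pos2_ne_pos2 hs (show 1 ≤ a - (2 * M + c) by omega)
          (show a - (2 * M + c) < b - (2 * M + c) by omega) (by omega) heq
  simp only [allTurnLoops, Finset.mem_filter, show 2 * M + 8 - 1 = 2 * M + 7 by omega,
    show 2 * M + 8 - 2 = 2 * M + 6 by omega]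
  refine ⟨mem_saws.2 ⟨by rw [P1 0 (Nat.zero_le _), hσ0], fun k hk => ?_, fun k hk => ?_, ?_⟩, ?_, ?_, ?_, ?_⟩
  · -- frozen after time `2M+7`
    rw [P4 k (by omega), P4 (2 * M + 7) (by omega), pos2_of_ge s (show 7 - len1 pj pi ≤ k - (2 * M + c) by omega),
      pos2_of_ge s (show 7 - len1 pj pi ≤ 2 * M + 7 - (2 * M + c) by omega)]
  · -- nearest-neighbour steps
    rcases lt_or_ge k M with h1 | h1
    · rw [P1 k h1.le, P1 (k + 1) (by omega)]
      exact hσadj k h1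
    rcases lt_or_ge k (M + c) with h2 | h2
    · rw [P2 k h1 h2.le, P2 (k + 1) (by omega) (by omega), show k + 1 - M = k - M + 1 by omega,
        add_comm x, add_comm x, zdGraph_adj_add_right]
      exact adj_off1 hs (by omega)
    rcases lt_or_ge k (2 * M + c) with h3 | h3
    · rw [P3 k h2 h3.le, P3 (k + 1) (by omega) (by omega), zdGraph_adj_add_right,
        show 2 * M + c - k = 2 * M + c - (k + 1) + 1 by omega]
      exact (hτadj _ (by omega)).symm
    · rw [P4 k h3, P4 (k + 1) (by omega), show k + 1 - (2 * M + c) = k - (2 * M + c) + 1 by omega]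
      exact adj_pos2 hs (by omega)
  · -- self-avoidance
    intro a ha b hb hab
    simp only [Set.mem_setOf_eq] at ha hb
    by_contra hne
    rcases Nat.lt_or_gt_of_ne hne with h | h
    · exact key a b h hb hab
    · exact key b a h ha hab.symm
  · -- all-turn
    rw [show 2 * M + 6 = 2 * M + 7 - 1 by omega, turns_eq_iff]
    intro j hj
    rcases Nat.lt_or_ge (j + 1) M with h1 | h1
    · rw [S1 (j + 1) h1, S1 j (by omega)]
      exact hσt j (by omega)
    rcases (show j + 1 = M ∨ M ≤ j by omega) with h2 | h2
    · rw [S2 (j + 1) (by omega) (by omega), S1 j (by omega), show j + 1 + 1 - M = 1 by omega,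
        show j + 1 - M = 0 by omega, show j = M - 1 by omega]
      exact off1_one_ne hs hσL
    rcases Nat.lt_or_ge (j + 1) (M + c) with h3 | h3
    · rw [S2 (j + 1) (by omega) h3, S2 j h2 (by omega), show j + 1 + 1 - M = j - M + 2 by omega,
        show j + 1 - M = j - M + 1 by omega]
      exact off1_turn hs (by omega)
    rcases (show j + 1 = M + c ∨ M + c ≤ j by omega) with h4 | h4
    · rw [S3 (j + 1) (by omega) (by omega), S2 j h2 (by omega), show 2 * M + c - (j + 1) - 1 = M - 1 by omega,
        show j + 1 - M = len1 pj pi by omega, show j - M = len1 pj pi - 1 by omega]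
      exact neg_ne_off1_last hs hτL
    rcases Nat.lt_or_ge (j + 1) (2 * M + c) with h5 | h5
    · rw [S3 (j + 1) (by omega) h5, S3 j h4 (by omega)]
      set n := 2 * M + c - (j + 1) - 1 with hn
      rw [show 2 * M + c - j - 1 = n + 1 by omega]
      intro h
      exact hτt n (by omega) (neg_injective h).symm
    rcases (show j + 1 = 2 * M + c ∨ 2 * M + c ≤ j by omega) with h6 | h6
    · rw [S4 (j + 1) (by omega), S3 j h4 (by omega), show j + 1 + 1 - (2 * M + c) = 1 by omega,
        show j + 1 - (2 * M + c) = 0 by omega, show 2 * M + c - j - 1 = 0 by omega]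
      exact pos2_one_ne hs hτF
    · rw [S4 (j + 1) (by omega), S4 j h6, show j + 1 + 1 - (2 * M + c) = j - (2 * M + c) + 2 by omega,
        show j + 1 - (2 * M + c) = j - (2 * M + c) + 1 by omega]
      exact pos2_turn hs (by omega)
  · -- the endpoint is a neighbour of the origin
    rw [P4 (2 * M + 7) (by omega), show 2 * M + 7 - (2 * M + c) = 7 - len1 pj pi by omega]
    exact adj_pos2_zero hs pj pi
  · -- the closing step turns relative to the last step
    rw [P4 (2 * M + 7) (by omega), P4 (2 * M + 6) (by omega), show 2 * M + 7 - (2 * M + c) = 7 - len1 pj pi by omega,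
      show 2 * M + 6 - (2 * M + c) = 7 - len1 pj pi - 1 by omega]
    exact zero_sub_pos2_ne hs pj pi
  · -- the first step turns relative to the closing step
    rw [P4 (2 * M + 7) (by omega), P1 1 hM, P1 0 (Nat.zero_le _),
      show 2 * M + 7 - (2 * M + c) = 7 - len1 pj pi by omega]
    exact ne_zero_sub_pos2 hs hσF

end Glue

/-! ### Two all-turn bridges with a common endpoint make an all-turn polygon: the code -/

section Count

variable {M : ℕ}

/-- `s = sgn x₁` (with `sgn 0 = 1`). [cite: MadrasSlade1993, §3.2 (proof of Theorem 3.2.4)] -/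
def sgn1 (x : Site 2) : ℤ := if x 1 < 0 then -1 else 1

/-- `s x₁ > 0` when `x₁ ≠ 0`. [cite: MadrasSlade1993, §3.2 (proof of Theorem 3.2.4)] -/
theorem sgn1_spec {x : Site 2} (hx : x 1 ≠ 0) :
    (sgn1 x = 1 ∧ 0 < x 1) ∨ (sgn1 x = -1 ∧ x 1 < 0) := by
  unfold sgn1
  split_ifs with h
  · exact Or.inr ⟨rfl, h⟩
  · exact Or.inl ⟨rfl, by omega⟩

/-- The parity of a re-rooting time, as a Boolean (`true` = odd). [cite: MadrasSlade1993, §3.2 (proof of Theorem 3.2.4)] -/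
def par (n : ℕ) : Bool := decide (n % 2 = 1)

/-- `par n = true ↔ n` odd. [cite: MadrasSlade1993, §3.2 (proof of Theorem 3.2.4)] -/
theorem par_eq_true_iff (n : ℕ) : par n = true ↔ n % 2 = 1 := by simp [par]

/-- `par n = false ↔ n` even. [cite: MadrasSlade1993, §3.2 (proof of Theorem 3.2.4)] -/
theorem par_eq_false_iff (n : ℕ) : par n = false ↔ n % 2 = 0 := by
  simp only [par, decide_eq_false_iff_not]
  omega

/-- `B^{AT}[M, x]`: the all-turn `M`-step bridges ending at `x`. [cite: MadrasSlade1993, §3.2 (proof of Theorem 3.2.4)] -/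
def atClass (M : ℕ) (x : Site 2) : Finset (ℕ → Site 2) := (allTurnBridges M).filter fun ω => ω M = x

/-- Membership in `B^{AT}[M, x]`. [cite: MadrasSlade1993, §3.2 (proof of Theorem 3.2.4)] -/
theorem mem_atClass {x : Site 2} {ω : ℕ → Site 2} : ω ∈ atClass M x ↔ ω ∈ allTurnBridges M ∧ ω M = x := by
  rw [atClass, Finset.mem_filter]

/-- `(ρ, i, j)` for a pair `(ω, υ)` of all-turn bridges ending at `x`: the all-turn polygon glued from `ῡ`
(re-rooted at its `φₓ`-minimum `j`) and `ω̄` (re-rooted at its `φₓ`-maximum `i`) through the connectors of design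
`(j mod 2, i mod 2)`, together with the two re-rooting times. [cite: MadrasSlade1993, §3.2 (proof of Theorem 3.2.4)] -/
def pairCodeAT (M : ℕ) (x : Site 2) (p : (ℕ → Site 2) × (ℕ → Site 2)) : (ℕ → Site 2) × ℕ × ℕ :=
  (glueAT M (sgn1 x) (par (argminPhi x M p.2)) (par (argmaxPhi x M p.1))
      (reroot M (argminPhi x M p.2) p.2) (reroot M (argmaxPhi x M p.1) p.1),
    argmaxPhi x M p.1, argminPhi x M p.2)

/-- The code of a pair of `B^{AT}[M, x]` (`M ≥ 3` even, `x₁ ≠ 0`) is a rooted all-turn `(2M+8)`-polygon with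
re-rooting times `≤ M`. [cite: MadrasSlade1993, §3.2 (proof of Theorem 3.2.4)] -/
theorem pairCodeAT_mem {x : Site 2} (hev : Even M) (hM : 3 ≤ M) (hx1 : x 1 ≠ 0)
    {p : (ℕ → Site 2) × (ℕ → Site 2)} (hp : p ∈ atClass M x ×ˢ atClass M x) :
    pairCodeAT M x p ∈ allTurnLoops (2 * M + 8) ×ˢ (Finset.range (M + 1) ×ˢ Finset.range (M + 1)) := by
  obtain ⟨ω, υ⟩ := p
  rw [Finset.mem_product] at hp
  obtain ⟨hω, hωM⟩ : ω ∈ allTurnBridges M ∧ ω M = x := mem_atClass.1 hp.1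
  obtain ⟨hυ, hυM⟩ : υ ∈ allTurnBridges M ∧ υ M = x := mem_atClass.1 hp.2
  have hωb := (mem_allTurnBridges.1 hω).1
  have hυb := (mem_allTurnBridges.1 hυ).1
  have hω0 : ω 0 = 0 := (mem_saws.1 (mem_bridges.1 hωb).1).1
  have hυ0 : υ 0 = 0 := (mem_saws.1 (mem_bridges.1 hυb).1).1
  obtain ⟨hi, himax⟩ := argmaxPhi_spec x M ω
  obtain ⟨hj, hjmin⟩ := argminPhi_spec x M υ
  have hx0 : 2 ≤ x 0 := hωM ▸ two_le_apply_zero_of_mem_allTurnBridges hω hM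
  simp only [pairCodeAT, Finset.mem_product, Finset.mem_range, Nat.lt_succ_iff]
  refine ⟨?_, hi, hj⟩
  refine glueAT_mem_allTurnLoops (by omega) (reroot_mem_saws hυb hj) (reroot_mem_saws hωb hi)
    (by rw [reroot_M hυ0 hj, hυM]) (by rw [reroot_M hω0 hi, hωM]) hx0 (sgn1_spec hx1)
    (fun k hk => ?_) (fun k hk => ?_) (turns_eq_iff.1 (turns_reroot hυ hev hj))
    (turns_eq_iff.1 (turns_reroot hω hev hi)) ?_ ?_ ?_ ?_
  · have h1 : ∀ k ≤ M, phi (υ M) (υ (argminPhi x M υ)) ≤ phi (υ M) (υ k) := by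
      rw [hυM]; exact hjmin
    have := phi_reroot_nonneg hj h1 k hk
    rwa [hυM] at this
  · have h1 : ∀ k ≤ M, phi (ω M) (ω k) ≤ phi (ω M) (ω (argmaxPhi x M ω)) := by
      rw [hωM]; exact himax
    have := phi_reroot_nonpos hi h1 k hk
    rwa [hωM] at this
  · rw [hz_stp_reroot_last hυ hev (by omega) hj, par_eq_true_iff]
  · rw [hz_stp_reroot_zero hυ hev (by omega) hj, par_eq_false_iff]
  · rw [hz_stp_reroot_last hω hev (by omega) hi, par_eq_true_iff]
  · rw [hz_stp_reroot_zero hω hev (by omega) hi, par_eq_false_iff]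

/-- "We could reconstruct the original bridges `ω` and `υ` if we only knew `i` and `j`": the code is injective
(the design and the connector lengths are functions of `(i, j)`). [cite: MadrasSlade1993, §3.2 (proof of Theorem 3.2.4)] -/
theorem pairCodeAT_injOn (x : Site 2) :
    Set.InjOn (pairCodeAT M x) ↑(atClass M x ×ˢ atClass M x) := by
  rintro ⟨ω, υ⟩ hp ⟨ω', υ'⟩ hp' hcode
  rw [Finset.coe_product, Set.mem_prod, Finset.mem_coe, Finset.mem_coe] at hp hp'
  obtain ⟨hωa, hωM⟩ : ω ∈ allTurnBridges M ∧ ω M = x := mem_atClass.1 hp.1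
  obtain ⟨hυa, hυM⟩ : υ ∈ allTurnBridges M ∧ υ M = x := mem_atClass.1 hp.2
  obtain ⟨hωa', hωM'⟩ : ω' ∈ allTurnBridges M ∧ ω' M = x := mem_atClass.1 hp'.1
  obtain ⟨hυa', hυM'⟩ : υ' ∈ allTurnBridges M ∧ υ' M = x := mem_atClass.1 hp'.2
  have hω : ω ∈ saws 2 M := (mem_bridges.1 (mem_allTurnBridges.1 hωa).1).1
  have hυ : υ ∈ saws 2 M := (mem_bridges.1 (mem_allTurnBridges.1 hυa).1).1
  have hω' : ω' ∈ saws 2 M := (mem_bridges.1 (mem_allTurnBridges.1 hωa').1).1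
  have hυ' : υ' ∈ saws 2 M := (mem_bridges.1 (mem_allTurnBridges.1 hυa').1).1
  have hω0 : ω 0 = 0 := (mem_saws.1 hω).1
  have hυ0 : υ 0 = 0 := (mem_saws.1 hυ).1
  have hω'0 : ω' 0 = 0 := (mem_saws.1 hω').1
  have hυ'0 : υ' 0 = 0 := (mem_saws.1 hυ').1
  simp only [pairCodeAT, Prod.mk.injEq] at hcode
  obtain ⟨hρ, hi, hj⟩ := hcode
  rw [hi, hj] at hρ
  have hi' := (argmaxPhi_spec x M ω').1
  have hj' := (argminPhi_spec x M υ').1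
  have c3 := (len1_le (par (argminPhi x M υ')) (par (argmaxPhi x M ω'))).1
  have hσ : ∀ k ≤ M, reroot M (argminPhi x M υ') υ k = reroot M (argminPhi x M υ') υ' k :=
    fun k hk => by
    have := congrFun hρ k
    rwa [glueAT_of_le hk, glueAT_of_le hk] at this
  have hτ : ∀ k ≤ M, reroot M (argmaxPhi x M ω') ω k = reroot M (argmaxPhi x M ω') ω' k := fun k hk => by
    have := congrFun hρ (2 * M + len1 (par (argminPhi x M υ')) (par (argmaxPhi x M ω')) - k)
    rw [glueAT_mid2 (x := x) (by rw [reroot_M hυ0 hj', hυM]) (by rw [reroot_M hω0 hi', hωM])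
        (by omega) (by omega),
      glueAT_mid2 (x := x) (by rw [reroot_M hυ'0 hj', hυM']) (by rw [reroot_M hω'0 hi', hωM'])
        (by omega) (by omega), add_left_inj,
      show 2 * M + len1 (par (argminPhi x M υ')) (par (argmaxPhi x M ω')) -
        (2 * M + len1 (par (argminPhi x M υ')) (par (argmaxPhi x M ω')) - k) = k by omega] at this
    exact this
  rw [eq_of_reroot_eq hω hω' hi' hτ, eq_of_reroot_eq hυ hυ' hj' hσ]

/-- `|B^{AT}[M,x]|² ≤ (M+1)² · q(2M+8)` for `M ≥ 3` even and `x₁ ≠ 0`. [cite: MadrasSlade1993, §3.2 (proof of Theorem 3.2.4)] -/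
theorem sq_card_atClass_le {x : Site 2} (hev : Even M) (hM : 3 ≤ M) (hx1 : x 1 ≠ 0) :
    (atClass M x).card ^ 2 ≤ (M + 1) ^ 2 * allTurnPolygonCount (2 * M + 8) := by
  have := Finset.card_le_card_of_injOn (pairCodeAT M x) (fun p hp => pairCodeAT_mem hev hM hx1 hp)
    (pairCodeAT_injOn x)
  rw [Finset.card_product, Finset.card_product, Finset.card_product, Finset.card_range] at this
  rw [sq, allTurnPolygonCount]
  linarith

end Count

/-! ### Extending an even all-turn bridge by `(+e₁, ±e₂)` -/

section Extend

variable {M : ℕ} {ω : ℕ → Site 2}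

/-- `ω`, then `+e₁`, then `s e₂` with `s = sgn ω(M)₁` (`+` if `ω(M)₁ = 0`): an all-turn `(M+2)`-bridge whose
endpoint has nonzero second coordinate. [cite: MadrasSlade1993, §3.2 (proof of Theorem 3.2.4)] -/
def extendBridgeAT (M : ℕ) (ω : ℕ → Site 2) (k : ℕ) : Site 2 :=
  if k ≤ M then ω k else if k = M + 1 then ω M + ![1, 0] else ω M + ![1, sgn1 (ω M)]

/-- On `[0, M]` the extension is `ω`. [cite: MadrasSlade1993, §3.2 (proof of Theorem 3.2.4)] -/
theorem extendBridgeAT_of_le {k : ℕ} (hk : k ≤ M) : extendBridgeAT M ω k = ω k := if_pos hk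

/-- At time `M+1` the extension is at `ω(M) + e₁`. [cite: MadrasSlade1993, §3.2 (proof of Theorem 3.2.4)] -/
theorem extendBridgeAT_succ : extendBridgeAT M ω (M + 1) = ω M + ![1, 0] := by
  rw [extendBridgeAT, if_neg (by omega), if_pos rfl]

/-- From time `M+2` on the extension sits at `ω(M) + (1, s)`. [cite: MadrasSlade1993, §3.2 (proof of Theorem 3.2.4)] -/
theorem extendBridgeAT_of_ge {k : ℕ} (hk : M + 2 ≤ k) : extendBridgeAT M ω k = ω M + ![1, sgn1 (ω M)] := by
  rw [extendBridgeAT, if_neg (by omega), if_neg (by omega)]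

/-- `s = ±1`. [cite: MadrasSlade1993, §3.2 (proof of Theorem 3.2.4)] -/
theorem sgn1_eq (x : Site 2) : sgn1 x = 1 ∨ sgn1 x = -1 := by
  unfold sgn1; split_ifs <;> simp

/-- **The extension of an even all-turn bridge is an all-turn `(M+2)`-bridge with `x₁ ≠ 0`.**
[cite: MadrasSlade1993, §3.2 (proof of Theorem 3.2.4)] -/
theorem extendBridgeAT_mem (hω : ω ∈ allTurnBridges M) (hev : Even M) (hM : 1 ≤ M) :
    extendBridgeAT M ω ∈ allTurnBridges (M + 2) ∧ extendBridgeAT M ω (M + 2) 1 ≠ 0 := by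
  obtain ⟨hb, ht⟩ := mem_allTurnBridges.1 hω
  obtain ⟨hs, hbr⟩ := mem_bridges.1 hb
  obtain ⟨h0, -, hadj, hinj⟩ := mem_saws.1 hs
  have h00 : ω 0 0 = 0 := by rw [h0]; rfl
  have hpar := hz_stp_iff_of_mem_allTurnBridges hω
  rw [turns_eq_iff] at ht
  have hsg := sgn1_eq (ω M)
  set β := extendBridgeAT M ω with hβ
  have P1 : ∀ k ≤ M, β k = ω k := fun k hk => extendBridgeAT_of_le hk
  have P2 : β (M + 1) = ω M + ![1, 0] := extendBridgeAT_succ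
  have P3 : ∀ k, M + 2 ≤ k → β k = ω M + ![1, sgn1 (ω M)] := fun k hk => extendBridgeAT_of_ge hk
  have hxM : 0 < ω M 0 := by have := (hbr M hM le_rfl).1; rwa [h00] at this
  -- first coordinates: old vertices `≤ ω M 0`, new ones `= ω M 0 + 1`
  have hold : ∀ k ≤ M, β k 0 ≤ ω M 0 := fun k hk => by
    rw [P1 k hk]
    rcases Nat.eq_zero_or_pos k with rfl | hk0
    · rw [h00]; exact hxM.le
    · exact (hbr k hk0 hk).2
  refine ⟨mem_allTurnBridges.2 ⟨mem_bridges.2 ⟨mem_saws.2 ⟨by rw [P1 0 (Nat.zero_le _), h0], fun k hk => ?_,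
    fun k hk => ?_, ?_⟩, fun k hk1 hk2 => ?_⟩, ?_⟩, ?_⟩
  · rw [P3 k hk, P3 (M + 2) le_rfl]
  · rcases lt_or_ge k M with h1 | h1
    · rw [P1 k h1.le, P1 (k + 1) h1]; exact hadj k h1
    rcases (show k = M ∨ k = M + 1 by omega) with rfl | rfl
    · rw [P1 k le_rfl, P2]
      exact adj_of_coords (by simp)
    · rw [P2, P3 (M + 1 + 1) (by omega)]
      refine adj_of_coords ?_
      rcases hsg with h | h <;> simp [h]
  · intro a ha b hb' hab
    simp only [Set.mem_setOf_eq] at ha hb'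
    by_contra hne
    have aux : ∀ a b, a < b → b ≤ M + 2 → β a ≠ β b := by
      intro a b hab hb heq
      rcases le_or_gt b M with h1 | h1
      · rw [P1 a (by omega), P1 b h1] at heq
        have := hinj (show a ≤ M by omega) (show b ≤ M from h1) heq
        omega
      rcases le_or_gt a M with h2 | h2
      · have ha0 := hold a h2
        have hb0 : β b 0 = ω M 0 + 1 := by
          rcases (show b = M + 1 ∨ b = M + 2 by omega) with rfl | rfl
          · rw [P2]; simp
          · rw [P3 _ le_rfl]; simp
        rw [heq] at ha0
        omega
      · obtain rfl : a = M + 1 := by omega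
        obtain rfl : b = M + 2 := by omega
        rw [P2, P3 _ le_rfl] at heq
        have := congrFun heq 1
        simp at this
        rcases hsg with h | h <;> simp [h] at this
    rcases Nat.lt_or_gt_of_ne hne with h | h
    · exact aux a b h hb' hab
    · exact aux b a h ha hab.symm
  · -- bridge
    rw [P1 0 (Nat.zero_le _), h00, P3 (M + 2) le_rfl]
    rcases le_or_gt k M with h1 | h1
    · refine ⟨?_, ?_⟩
      · rw [P1 k h1]; have := (hbr k hk1 h1).1; rwa [h00] at this
      · have := hold k h1; simp; omega
    · rcases (show k = M + 1 ∨ k = M + 2 by omega) with rfl | rfl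
      · rw [P2]; simp; omega
      · rw [P3 _ le_rfl]; simp; omega
  · -- all-turn
    refine turns_eq_iff.2 fun j hj => ?_
    have S1 : ∀ k < M, stp β k = stp ω k := fun k hk => by
      simp only [stp, P1 k hk.le, P1 (k + 1) (Nat.succ_le_of_lt hk)]
    have S2 : stp β M = ![1, 0] := by
      simp only [stp, P2, P1 M le_rfl, add_sub_cancel_left]
    have S3 : stp β (M + 1) = ![0, sgn1 (ω M)] := by
      simp only [stp, P3 (M + 1 + 1) (by omega), P2, add_sub_add_left_eq_sub]
      funext r; fin_cases r <;> simp
    rcases Nat.lt_or_ge (j + 1) M with h1 | h1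
    · rw [S1 (j + 1) h1, S1 j (by omega)]; exact ht j (by omega)
    rcases (show j + 1 = M ∨ j = M by omega) with h2 | rfl
    · rw [h2, S2, S1 j (by omega)]
      -- the last step of `ω` is vertical
      have hv := hpar j (by omega)
      intro h
      have e1 := congrFun h 1
      unfold hz at hv
      simp at e1
      have : j % 2 = 0 := hv.1 e1.symm
      obtain ⟨r, hr⟩ := hev
      omega
    · rw [S3, S2]
      intro h
      have e0 := congrFun h 0
      simp at e0
  · rw [P3 (M + 2) le_rfl]
    have := hsg
    unfold sgn1 at this ⊢
    split_ifs with h <;> simp <;> omega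

/-- The extension is injective on all-turn `M`-bridges (they are frozen after time `M`). [cite: MadrasSlade1993, §3.2 (proof of Theorem 3.2.4)] -/
theorem extendBridgeAT_injOn : Set.InjOn (extendBridgeAT M) ↑(allTurnBridges M) := by
  intro ω hω ω' hω' h
  rw [Finset.mem_coe] at hω hω'
  have hs := (mem_bridges.1 (mem_allTurnBridges.1 hω).1).1
  have hs' := (mem_bridges.1 (mem_allTurnBridges.1 hω').1).1
  have hM : ∀ k ≤ M, ω k = ω' k := fun k hk => by
    have := congrFun h k
    rwa [extendBridgeAT_of_le hk, extendBridgeAT_of_le hk] at this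
  funext k
  rcases le_or_gt k M with hk | hk
  · exact hM k hk
  · rw [(mem_saws.1 hs).2.1 k hk.le, (mem_saws.1 hs').2.1 k hk.le, hM M le_rfl]

/-- `b^{AT}(M) ≤ #{β ∈ B^{AT}(M+2) : β(M+2)₁ ≠ 0}` for even `M ≥ 1`. [cite: MadrasSlade1993, §3.2 (proof of Theorem 3.2.4)] -/
theorem allTurnBridgeCount_le_card_filter (hev : Even M) (hM : 1 ≤ M) :
    allTurnBridgeCount M ≤ ((allTurnBridges (M + 2)).filter fun β => β (M + 2) 1 ≠ 0).card := by
  rw [allTurnBridgeCount]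
  refine Finset.card_le_card_of_injOn (extendBridgeAT M) (fun ω hω => ?_) extendBridgeAT_injOn
  exact Finset.mem_coe.2 (Finset.mem_filter.2 (extendBridgeAT_mem (Finset.mem_coe.1 hω) hev hM))

end Extend

/-! ### Assembly: pigeonhole over the endpoint classes -/

/-- **K2 «L-POLY»: two all-turn bridges make an all-turn polygon** — for even `M ≥ 2`,
`b^{AT}(M)² ≤ 16 (2M+5)⁴ (M+3)² · q(2M+12)` (Madras–Slade Theorem 3.2.4 run inside the all-turn class: extend to
`(M+2)`-bridges with `x₁ ≠ 0`, pigeonhole over the `(2M+5)²` endpoints of the box, and `|B^{AT}[M+2,x]|² ≤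
(M+3)² q(2M+12)` by the parity-adaptive gluing). [cite: MadrasSlade1993, Theorem 3.2.4] -/
theorem allTurnPolygonsFromBridges : AllTurnPolygonsFromBridges := by
  intro M hM hev
  have hev' : Even (M + 2) := by obtain ⟨r, hr⟩ := hev; exact ⟨r + 1, by omega⟩
  set B' := (allTurnBridges (M + 2)).filter (fun β => β (M + 2) 1 ≠ 0) with hB'
  have h1 : allTurnBridgeCount M ≤ B'.card := allTurnBridgeCount_le_card_filter hev (by omega)
  set keys := box 2 (M + 2) with hkeys
  have hmaps : ∀ β ∈ B', β (M + 2) ∈ keys := fun β hβ => by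
    rw [hB', Finset.mem_filter] at hβ
    exact apply_mem_box_of_mem_saws (mem_bridges.1 (mem_allTurnBridges.1 hβ.1).1).1
  have hsum : B'.card = ∑ y ∈ keys, (B'.filter fun β => β (M + 2) = y).card :=
    Finset.card_eq_sum_card_fiberwise hmaps
  have hne : keys.Nonempty := ⟨0, by
    rw [hkeys, mem_box]
    intro i
    simp only [Pi.zero_apply]
    constructor <;> omega⟩
  obtain ⟨y, -, hle⟩ : ∃ y ∈ keys, B'.card ≤ keys.card * (B'.filter fun β => β (M + 2) = y).card := by
    refine Finset.exists_le_of_sum_le hne ?_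
    rw [Finset.sum_const, smul_eq_mul, ← Finset.mul_sum, ← hsum]
  rw [hkeys, card_box] at hle
  by_cases h0 : (B'.filter fun β => β (M + 2) = y).card = 0
  · rw [h0, mul_zero] at hle
    have : allTurnBridgeCount M = 0 := by omega
    rw [this]
    simp
  obtain ⟨β, hβ⟩ := Finset.card_pos.1 (Nat.pos_of_ne_zero h0)
  rw [Finset.mem_filter, hB', Finset.mem_filter] at hβ
  have hy1 : y 1 ≠ 0 := by rw [← hβ.2]; exact hβ.1.2
  have hsub : (B'.filter fun β => β (M + 2) = y) ⊆ atClass (M + 2) y := by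
    intro γ hγ
    rw [Finset.mem_filter, hB', Finset.mem_filter] at hγ
    exact mem_atClass.2 ⟨hγ.1.1, hγ.2⟩
  have h2 := Finset.card_le_card hsub
  have h3 := sq_card_atClass_le (M := M + 2) hev' (by omega) hy1
  have h4 : allTurnBridgeCount M ≤ (2 * (M + 2) + 1) ^ 2 * (atClass (M + 2) y).card :=
    h1.trans (hle.trans (Nat.mul_le_mul_left _ h2))
  calc allTurnBridgeCount M ^ 2 ≤ ((2 * (M + 2) + 1) ^ 2 * (atClass (M + 2) y).card) ^ 2 :=
        Nat.pow_le_pow_left h4 2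
    _ = (2 * M + 5) ^ 4 * (atClass (M + 2) y).card ^ 2 := by ring
    _ ≤ (2 * M + 5) ^ 4 * ((M + 2 + 1) ^ 2 * allTurnPolygonCount (2 * (M + 2) + 8)) :=
        Nat.mul_le_mul_left _ h3
    _ = 1 * ((2 * M + 5) ^ 4 * (M + 3) ^ 2 * allTurnPolygonCount (2 * M + 12)) := by
        rw [show M + 2 + 1 = M + 3 by ring, show 2 * (M + 2) + 8 = 2 * M + 12 by ring]; ring
    _ ≤ 16 * ((2 * M + 5) ^ 4 * (M + 3) ^ 2 * allTurnPolygonCount (2 * M + 12)) :=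
        Nat.mul_le_mul_right _ (by norm_num)
    _ = 16 * (2 * M + 5) ^ 4 * (M + 3) ^ 2 * allTurnPolygonCount (2 * M + 12) := by ring

/-- Exact-name discharge of the closed `Prop` `AllTurnPolygonsFromBridges` (all-turn polygons from two
all-turn bridges with explicit polynomial loss), for the facts census: it is the theorem
`allTurnPolygonsFromBridges`. [cite: MadrasSlade1993, §3.2 (proof of Theorem 3.2.4)] -/
theorem AllTurnPolygonsFromBridges_holds : AllTurnPolygonsFromBridges :=
  allTurnPolygonsFromBridges

end Literature.Probability.RandomPlanarGeometry.SAW.Zd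

end
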